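import Mathlib.Data.Fintype.Card
import Mathlib.Data.Finset.Card
import Mathlib.Data.Finset.Powerset
import Mathlib.Algebra.BigOperators.Group.Finset.Basic
import Mathlib.Algebra.Order.BigOperators.Group.Finset
import Mathlib.Combinatorics.Enumerative.DoubleCounting
import Mathlib.Tactic
import HarnessLib
import Summits.Ventures.HSemireg.NoFlatTwoDPlusOneDichotomy

/-!
# Venture HSemireg — no flat (d, 2d+1) triangle-free three-coordinate system for any d ≥ 3

Cell `pub-hsemireg`, widening group W5, seat w5-n7-1 (gen 14); note of record
`widen/W5/NO-FLAT-3-7-w5n7g13.md` §4 THEOREM (T-all) (hand proof by gen 13, machine cross-check of its `G_AB` core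
for `d ≤ 6`); the general-`d` companion of the tree leg `NoFlatThreeSeven` (the case `d = 3`, where the twin-free
branch closes by parity). Part 2 of 2: the shadows ∕ mates ∕ dichotomy ∕ twin-branch lemmas are imported from
`NoFlatTwoDPlusOneDichotomy`.

SETTING (the lineage's abstract encoding, as in `FlatPentagonTwinFree` and `NoFlatThreeSeven`): three coordinates
with level types `α, β, γ` of `2d+1` elements each; neighbourhood maps with transposes (`nAB/nBA`, `nAC/nCA`,
`nBC/nCB`), every level has exactly `d` neighbours in each other coordinate (a flat `(d, 2d+1)` system), and a
TRIANGLE is a triple `a, b, c` with `b ∈ nAB a`, `c ∈ nBC b`, `c ∈ nAC a`.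

THEOREM `exists_triangle`: for `d ≥ 3` such a system always has a triangle. Equivalently there is no flat
`(d, 2d+1)` triangle-free three-coordinate system — `(3,7), (4,9), (5,11), (6,13), …` — a fortiori none on four or
more coordinates. SHARPNESS in `d`: at `d = 2` the pentagon design of `FlatDesignPentagon` is a flat `(2,5)`
triangle-free system (unique by `FlatPentagonTwinFree` and the note PENTAGON-UNIQUENESS), and `(1,3)` systems exist;
in `t`: at `(3,8)` the circulant system `S = U = {0,1,2}`, `T = {5,6,7}` of the note's remark (i) is triangle-free.

PROOF: a twin pair is impossible by `false_of_twins` (part 1, `d ≥ 2`); the twin-free case is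
`false_of_twin_free` below (`d ≥ 3`): fix `a`, `X = nAB a` and the mate set `M` of `a` (`#M = d`, codegrees `d-1`,
non-mates avoid `X`). (i) Every `b ∈ X` has `A`-neighbourhood `{a} ∪ {mates containing b}`, so exactly ONE mate
misses `b`. (ii) Two distinct mates meet inside `X` in `≥ d-2 ≥ 1` levels, so they are mates of each other with
codegree `d-1`; if their single levels outside `X` differed, their common block would lie inside `X` and the level
of `X` missed by one would be missed by the other — against (i). Hence all mates share one level `y ∉ X`,
`nBA y = M`, and the `d ≥ 2` levels outside `{a} ∪ M` all have block `(X ∪ {y})ᶜ` — twins, contradiction.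

HONEST FRAMING: finite combinatorics on `(2d+1) + (2d+1) + (2d+1)` levels (necessary first-order conditions of the
flat cells of the widening tables). Nothing in this file is a statement about a variety, a sheaf or a Hodge class,
and nothing here bears on HC / HC_CM / HC_AV.
-/

namespace Summit.Ventures.HSemireg.NoFlatTwoDPlusOne

open Finset Summit.Ventures.HSemireg.NoFlatTwoDPlusOneDichotomy

variable {α β γ : Type*} [Fintype α] [Fintype β] [Fintype γ] [DecidableEq α] [DecidableEq β] [DecidableEq γ]

/-- **The twin-free branch** (`d ≥ 3`). If no two levels of `A` have the same `B`-neighbourhood, the system is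
contradictory. Fix `a`, `X = nAB a` and the mate set `M` of `a` (`#M = d`, codegrees `d - 1`, non-mates avoid `X`,
by `card_mates_of_twin_free`). (i) Every `b ∈ X` has `A`-neighbourhood `{a} ∪ {mates containing b}`, so exactly ONE
mate misses `b`. (ii) Two distinct mates `a₁, a₂` meet inside `X` in `≥ d - 2 ≥ 1` levels, so they are mates of
each other, with codegree `d - 1` (dichotomy at `a₁`); if their single levels `y₁ ≠ y₂` outside `X` differed,
`nAB a₁ ∩ nAB a₂` would lie inside `X` and equal `X ∩ nAB a₂`, so the level of `X` missed by `nAB a₁` would be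
missed by `nAB a₂` as well — against (i). Hence all mates share one level `y ∉ X`, `nBA y = M`, and every level
outside `{a} ∪ M` has its block equal to `(X ∪ {y})ᶜ`, a `d`-set: the `d ≥ 2` such levels are twins —
contradiction. -/
theorem false_of_twin_free (d : ℕ) (hd : 3 ≤ d) (hα : Fintype.card α = 2 * d + 1)
    (hβ : Fintype.card β = 2 * d + 1) (hγ : Fintype.card γ = 2 * d + 1)
    (nAB : α → Finset β) (nBA : β → Finset α) (nAC : α → Finset γ) (nBC : β → Finset γ) (nCB : γ → Finset β)
    (cAB : ∀ a b, b ∈ nAB a ↔ a ∈ nBA b) (cBC : ∀ b c, c ∈ nBC b ↔ b ∈ nCB c)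
    (rAB : ∀ a, (nAB a).card = d) (rBA : ∀ b, (nBA b).card = d) (rAC : ∀ a, (nAC a).card = d)
    (rBC : ∀ b, (nBC b).card = d) (rCB : ∀ c, (nCB c).card = d)
    (tABC : ∀ a b c, b ∈ nAB a → c ∈ nBC b → c ∉ nAC a)
    (htf : ∀ a₁ a₂, a₁ ≠ a₂ → nAB a₁ ≠ nAB a₂) : False := by
  have hd2 : 2 ≤ d := by omega
  obtain ⟨a⟩ : Nonempty α := Fintype.card_pos_iff.1 (by rw [hα]; omega)
  obtain ⟨hMcard, hMdeg⟩ := card_mates_of_twin_free d hd2 hβ hγ nAB nBA nAC nBC nCB cAB cBC rAB rBA rAC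
    rBC rCB tABC a (fun a' h => htf a' a h)
  set M := (univ.erase a).filter (fun a' => (nAB a ∩ nAB a').card ≠ 0) with hM
  have hmemM : ∀ a', a' ∈ M ↔ a' ≠ a ∧ (nAB a ∩ nAB a').card ≠ 0 := by
    intro a'
    rw [hM, mem_filter, mem_erase]
    simp only [mem_univ, and_true]
  have haM : a ∉ M := fun h => ((hmemM a).1 h).1 rfl
  -- non-mates avoid X
  have havoid : ∀ a', a' ≠ a → a' ∉ M → ∀ b ∈ nAB a, b ∉ nAB a' := by
    intro a' hne hnot b hb hb'
    exact hnot ((hmemM a').2 ⟨hne, (card_pos.2 ⟨b, mem_inter.2 ⟨hb, hb'⟩⟩).ne'⟩)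
  -- (i) the A-neighbourhood of a level b ∈ X
  have hnBA : ∀ b ∈ nAB a, nBA b = insert a (M.filter (fun a' => b ∈ nAB a')) := by
    intro b hb
    ext a'
    rw [mem_insert, mem_filter, ← cAB]
    constructor
    · intro h
      by_cases hne : a' = a
      · exact Or.inl hne
      · exact Or.inr ⟨(hmemM a').2 ⟨hne, (card_pos.2 ⟨b, mem_inter.2 ⟨hb, h⟩⟩).ne'⟩, h⟩
    · rintro (rfl | ⟨_, h⟩)
      · exact hb
      · exact h
  -- exactly one mate misses b
  have hmiss : ∀ b ∈ nAB a, (M.filter (fun a' => b ∉ nAB a')).card = 1 := by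
    intro b hb
    have h1 := rBA b
    have hnot : a ∉ M.filter (fun a' => b ∈ nAB a') := fun h => haM (mem_filter.1 h).1
    rw [hnBA b hb, card_insert_of_notMem hnot] at h1
    have h2 := card_filter_add_card_filter_not (s := M) (fun a' => b ∈ nAB a')
    rw [hMcard] at h2
    omega
  -- a mate's block has one level outside X and misses one level of X
  have hout : ∀ a' ∈ M, (nAB a' \ nAB a).card = 1 := by
    intro a' ha'
    have h1 := card_sdiff_add_card_inter (nAB a') (nAB a)
    rw [rAB, inter_comm] at h1
    have := hMdeg a' ha'
    omega
  have hin : ∀ a' ∈ M, (nAB a \ nAB a').card = 1 := by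
    intro a' ha'
    have h1 := card_sdiff_add_card_inter (nAB a) (nAB a')
    rw [rAB] at h1
    have := hMdeg a' ha'
    omega
  -- (ii) two distinct mates have the same level outside X
  have hsame : ∀ a₁ ∈ M, ∀ a₂ ∈ M, a₁ ≠ a₂ → nAB a₁ \ nAB a = nAB a₂ \ nAB a := by
    intro a₁ h₁ a₂ h₂ hne
    -- the two blocks meet inside X in ≥ d - 2 levels
    have hc : d ≤ (nAB a ∩ (nAB a₁ ∩ nAB a₂)).card + 2 := by
      have hsub : nAB a \ (nAB a₁ ∩ nAB a₂) ⊆ (nAB a \ nAB a₁) ∪ (nAB a \ nAB a₂) := by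
        intro b hb
        rw [mem_sdiff, mem_inter, not_and_or] at hb
        rw [mem_union, mem_sdiff, mem_sdiff]
        rcases hb.2 with h | h
        · exact Or.inl ⟨hb.1, h⟩
        · exact Or.inr ⟨hb.1, h⟩
      have h1 := (card_le_card hsub).trans (card_union_le _ _)
      rw [hin a₁ h₁, hin a₂ h₂] at h1
      have h2 := card_sdiff_add_card_inter (nAB a) (nAB a₁ ∩ nAB a₂)
      rw [rAB] at h2
      omega
    -- so they are mates of each other, with codegree d - 1 (dichotomy at a₁)
    have hne0 : (nAB a₁ ∩ nAB a₂).card ≠ 0 := by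
      have : (nAB a ∩ (nAB a₁ ∩ nAB a₂)).card ≤ (nAB a₁ ∩ nAB a₂).card :=
        card_le_card inter_subset_right
      omega
    obtain ⟨-, hdeg₁⟩ := card_mates_of_twin_free d hd2 hβ hγ nAB nBA nAC nBC nCB cAB cBC rAB rBA rAC rBC
      rCB tABC a₁ (fun a' h => htf a' a₁ h)
    have ha₂M₁ : a₂ ∈ (univ.erase a₁).filter (fun a' => (nAB a₁ ∩ nAB a').card ≠ 0) := by
      rw [mem_filter, mem_erase]
      exact ⟨⟨hne.symm, mem_univ _⟩, hne0⟩
    have h12 : (nAB a₁ ∩ nAB a₂).card + 1 = d := hdeg₁ a₂ ha₂M₁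
    -- suppose the outside levels differ
    by_contra hdiff
    obtain ⟨y₁, hy₁⟩ := card_eq_one.1 (hout a₁ h₁)
    obtain ⟨y₂, hy₂⟩ := card_eq_one.1 (hout a₂ h₂)
    have hy : y₁ ≠ y₂ := fun h => hdiff (by rw [hy₁, hy₂, h])
    -- then the common block lies inside X …
    have hsubX : nAB a₁ ∩ nAB a₂ ⊆ nAB a := by
      intro b hb
      rw [mem_inter] at hb
      by_contra hbX
      have h1' : b ∈ nAB a₁ \ nAB a := mem_sdiff.2 ⟨hb.1, hbX⟩
      have h2' : b ∈ nAB a₂ \ nAB a := mem_sdiff.2 ⟨hb.2, hbX⟩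
      rw [hy₁, mem_singleton] at h1'
      rw [hy₂, mem_singleton] at h2'
      exact hy (h1'.symm.trans h2')
    -- … and equals X ∩ nAB a₂ (same cardinality d - 1)
    have hE2 : nAB a ∩ nAB a₂ = nAB a₁ ∩ nAB a₂ := by
      symm
      apply eq_of_subset_of_card_le
      · intro b hb
        exact mem_inter.2 ⟨hsubX hb, (mem_inter.1 hb).2⟩
      · have := hMdeg a₂ h₂
        omega
    -- the level x of X missed by nAB a₁ is then also missed by nAB a₂
    obtain ⟨x, hx⟩ := card_eq_one.1 (hin a₁ h₁)
    have hx1 : x ∈ nAB a \ nAB a₁ := by rw [hx]; exact mem_singleton_self x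
    rw [mem_sdiff] at hx1
    have hx2 : x ∉ nAB a₂ := by
      intro h
      have : x ∈ nAB a ∩ nAB a₂ := mem_inter.2 ⟨hx1.1, h⟩
      rw [hE2, mem_inter] at this
      exact hx1.2 this.1
    -- two distinct mates miss x: contradiction with (i)
    have h2le : 2 ≤ (M.filter (fun a' => x ∉ nAB a')).card := by
      have hpair : ({a₁, a₂} : Finset α) ⊆ M.filter (fun a' => x ∉ nAB a') := by
        intro a' ha'
        rw [mem_insert, mem_singleton] at ha'
        rw [mem_filter]
        rcases ha' with rfl | rfl
        · exact ⟨h₁, hx1.2⟩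
        · exact ⟨h₂, hx2⟩
      have := card_le_card hpair
      rwa [card_pair hne] at this
    have := hmiss x hx1.1
    omega
  -- one mate a₁ and its level y outside X; every mate contains y
  obtain ⟨a₁, h₁⟩ : M.Nonempty := card_pos.1 (by rw [hMcard]; omega)
  obtain ⟨y, hy⟩ := card_eq_one.1 (hout a₁ h₁)
  have hy₁ : y ∈ nAB a₁ \ nAB a := by rw [hy]; exact mem_singleton_self y
  have hyX : y ∉ nAB a := (mem_sdiff.1 hy₁).2
  have hyM : ∀ a' ∈ M, y ∈ nAB a' := by
    intro a' ha'
    by_cases hne : a' = a₁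
    · rw [hne]
      exact (mem_sdiff.1 hy₁).1
    · have hmem : y ∈ nAB a' \ nAB a := by
        rw [hsame a' ha' a₁ h₁ hne, hy]
        exact mem_singleton_self y
      exact (mem_sdiff.1 hmem).1
  -- hence nBA y = M
  have hnBAy : nBA y = M := by
    symm
    apply eq_of_subset_of_card_le
    · intro a' ha'
      exact (cAB a' y).1 (hyM a' ha')
    · rw [rBA, hMcard]
  -- every level outside T' = {a} ∪ M has block (X ∪ {y})ᶜ
  set T' : Finset α := insert a M with hT'
  have hT'card : T'.card = d + 1 := by rw [hT', card_insert_of_notMem haM, hMcard]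
  set S : Finset β := insert y (nAB a) with hS
  have hScard : S.card = d + 1 := by rw [hS, card_insert_of_notMem hyX, rAB]
  have hblock : ∀ u, u ∉ T' → nAB u = Sᶜ := by
    intro u hu
    rw [hT', mem_insert, not_or] at hu
    apply eq_of_subset_of_card_le
    · intro b hb
      rw [mem_compl, hS, mem_insert, not_or]
      refine ⟨?_, fun hbX => havoid u hu.1 hu.2 b hbX hb⟩
      rintro rfl
      exact hu.2 (hnBAy ▸ (cAB u b).1 hb)
    · rw [card_compl, hScard, hβ, rAB]
      omega
  -- two distinct levels outside T' are twins
  have hT'c : (T'ᶜ).card = d := by rw [card_compl, hT'card, hα]; omega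
  obtain ⟨u, hu, v, hv, hne⟩ : ∃ u ∈ T'ᶜ, ∃ v ∈ T'ᶜ, u ≠ v := one_lt_card.1 (by rw [hT'c]; omega)
  rw [mem_compl] at hu hv
  exact htf u v hne (by rw [hblock u hu, hblock v hv])

/-- **THEOREM (no flat (d, 2d+1) triangle-free three-coordinate system, d ≥ 3).** Three `(2d+1)`-sets of levels
with `d`-regular bipartite torus graphs between every two of them always contain a triangle: levels `a, b, c` with
`b ∈ nAB a`, `c ∈ nBC b`, `c ∈ nAC a`. (Twin-free ⇒ `false_of_twin_free`; twins ⇒ `false_of_twins`.) In the cell's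
language: no flat `(d, 2d+1)` cell with `d ≥ 3` — `(3,7), (4,9), (5,11), (6,13), …`, on three, four or more
coordinates — passes the triangle filter. -/
theorem exists_triangle (d : ℕ) (hd : 3 ≤ d) (hα : Fintype.card α = 2 * d + 1)
    (hβ : Fintype.card β = 2 * d + 1) (hγ : Fintype.card γ = 2 * d + 1)
    (nAB : α → Finset β) (nBA : β → Finset α) (nAC : α → Finset γ) (nCA : γ → Finset α)
    (nBC : β → Finset γ) (nCB : γ → Finset β)
    (cAB : ∀ a b, b ∈ nAB a ↔ a ∈ nBA b) (cAC : ∀ a c, c ∈ nAC a ↔ a ∈ nCA c)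
    (cBC : ∀ b c, c ∈ nBC b ↔ b ∈ nCB c)
    (rAB : ∀ a, (nAB a).card = d) (rBA : ∀ b, (nBA b).card = d) (rAC : ∀ a, (nAC a).card = d)
    (rCA : ∀ c, (nCA c).card = d) (rBC : ∀ b, (nBC b).card = d) (rCB : ∀ c, (nCB c).card = d) :
    ∃ a b c, b ∈ nAB a ∧ c ∈ nBC b ∧ c ∈ nAC a := by
  by_contra h
  push Not at h
  by_cases htf : ∀ a₁ a₂, a₁ ≠ a₂ → nAB a₁ ≠ nAB a₂
  · exact false_of_twin_free d hd hα hβ hγ nAB nBA nAC nBC nCB cAB cBC rAB rBA rAC rBC rCB h htf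
  · push Not at htf
    obtain ⟨a₁, a₂, hne, htw⟩ := htf
    exact false_of_twins d (by omega) hα hβ hγ nAB nBA nAC nCA nBC nCB cAB cAC cBC rAB rBA rAC rCA rBC
      rCB h hne htw

/-- The same theorem in the lineage's hypothesis form: for `d ≥ 3` a flat `(d, 2d+1)` three-coordinate system with
the triangle-freeness hypothesis `tABC` is contradictory. -/
theorem no_flat_two_d_add_one (d : ℕ) (hd : 3 ≤ d) (hα : Fintype.card α = 2 * d + 1)
    (hβ : Fintype.card β = 2 * d + 1) (hγ : Fintype.card γ = 2 * d + 1)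
    (nAB : α → Finset β) (nBA : β → Finset α) (nAC : α → Finset γ) (nCA : γ → Finset α)
    (nBC : β → Finset γ) (nCB : γ → Finset β)
    (cAB : ∀ a b, b ∈ nAB a ↔ a ∈ nBA b) (cAC : ∀ a c, c ∈ nAC a ↔ a ∈ nCA c)
    (cBC : ∀ b c, c ∈ nBC b ↔ b ∈ nCB c)
    (rAB : ∀ a, (nAB a).card = d) (rBA : ∀ b, (nBA b).card = d) (rAC : ∀ a, (nAC a).card = d)
    (rCA : ∀ c, (nCA c).card = d) (rBC : ∀ b, (nBC b).card = d) (rCB : ∀ c, (nCB c).card = d)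
    (tABC : ∀ a b c, b ∈ nAB a → c ∈ nBC b → c ∉ nAC a) : False := by
  obtain ⟨a, b, c, hab, hbc, hac⟩ :=
    exists_triangle d hd hα hβ hγ nAB nBA nAC nCA nBC nCB cAB cAC cBC rAB rBA rAC rCA rBC rCB
  exact tABC a b c hab hbc hac

end Summit.Ventures.HSemireg.NoFlatTwoDPlusOne
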